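import Summits.HodgeConjecture.HodgeConjecture.Theorems.F0P3GuardedLettersOfGuardedShape    -- ★ ED. 2 (the `h2` edition): same imports ∕ opens ∕ lemmas; this file is its TWO-COMPACT-PLACE twin
import Summits.HodgeConjecture.HodgeConjecture.Theorems.F0P3HodgeTypeRigidOfBetaOppAdmCot3   -- ★ (E-3a): `hodgeTypeRigid_of_betaOppAdmCot_cpt₃` (E2′₃ from β_opp-adm-cot₃ + F1a)
import Summits.HodgeConjecture.HodgeConjecture.Theorems.F0P3ThreadLetters3Defs             -- ★ the letter texts `StubE1coh₃`, `HodgeTypeRigid₃` (S5-R20: ONE home, BY NAME)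
import HarnessLib

/-!
# Crux `H413` — rung 4 glue, part 4, TWO-COMPACT-PLACE TWIN (R90-TF THREAD-₃ lane 2, file (E-3b)): the v4 head of T5 at frames with TWO compact places
# `∀ compact CM frame with 3 ≤ [L⁺:ℚ], (C1♮) ∧ (C2♯) ∧ (C3♯)` ⇒ `StubE1coh₃` ∧ β_opp-adm-cot₃ ∧ letter E2′₃ `HodgeTypeRigid₃`

F0∕P3 «U3-mult», cell `hodgecm-mathlib`, crux H413 (`stmt-HodgeConjecture-24833`); R90-TF slab S5 seat R90-C133-p03 (g4), deal (H25) → E-3 (S5 dealer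
R90-C133-plan (g3) 2026-09-05T03:00:09Z ∕ 03:02:55Z); census `R90/R90-C133-p01/g2/CENSUS-L7.md` 9974659a §3 (E-3); heir LEAD F0P3a-plan (g22) RULING (R-44)
(C)(7); director (g40) s2043 (c)(ii)(iii); RULING S5-R19 «₃ twins live Summits-side»; RULING S5-R20 «ONE TEXT HOME, TWO LANES» (letter texts BY NAME from ★
`F0P3ThreadLetters3Defs`).  PROOF lane (theorems only; no `def`, no instance, no notation, no `sorry`); ADDITIVE (a new module beside ★
`F0P3GuardedLettersOfGuardedShape`, which is untouched and imported for its imports and lemmas); `--supports stmt-HodgeConjecture-24833 --as helper`.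
HONEST LABEL: this file pays nothing until AGG's ₃ edition consumes it; HC_CM is proved only modulo the 7 printed citations (2 remaining named inputs:
hLiu418 = stmt-HodgeConjecture-24832, h413 = stmt-HodgeConjecture-24833) until rung 0 closes.

WHY A TWIN.  The R90-TF road pays letter #80's finite-place organ from the Arthur-simple trace formula, which needs TWO compact real places of the definite
unitary group (`3 ≤ [L⁺:ℚ]`); AGG (`Lines/F0_U3LettersRung1.lean`) DERIVES E1_coh ∕ E2′ from the rung-0 rows (:651 ★ `letters_of_specPkgV8W_cot`), and the rows
need `stub_L3` (:582), so once `stub_S2sharp₃ ∕ stub_L3₃` carry `3 ≤` the V8 engine chain runs in the ₃ currency: (E-2) ★-to-be `shapeGuarded₃_of_T5` concludes the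
v4 head text with ONE inserted `3 ≤ …` line — the hypothesis `h` of §3∕§4 below, token for token — and (E-1) ★-to-be `letters_of_kitFamilyOfRecordV8W₃ ∕
letters_of_specPkgV8W_cot₃` read §4's output `StubE1coh₃ ∧ HodgeTypeRigid₃`.

WHAT CHANGES w.r.t. ★ `F0P3GuardedLettersOfGuardedShape` ED. 2 (everything else VERBATIM): every ∀-frame TEXT this file introduces or concludes ((C1♮), (C3♯), the v4
head, β_opp-adm-cot, `StubE1coh`'s body) gains ONE inserted line `3 ≤ Module.finrank ℚ ↥(maximalRealSubfield L) →` after the kept `2 ≤ …` line (CONVENTION OF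
RECORD S5-R19), `StubE1coh₃` ∕ `HodgeTypeRigid₃` are cited BY NAME from ★ `F0P3ThreadLetters3Defs`; each proof introduces `h3` beside `h2` and passes `hdef h2 h3` at
the ONE application of its ₃ hypothesis (`hC1c` ★ :110, `hC3c` ★ :191, `h` ★ :298–:299); the frame-local ★ inputs (`exists_muOmega`,
`cmCompactFactor_rightRegular_eq_self_of_isHolOrAntihol`, `exists_cohToken_of_isHolOrAntihol_cpt … hdef h2`, T♭ `memXiFamily_transfer_cm`, GUARDED U♭ `memXiFamily_rigid_cm`
(text `hUσ` VERBATIM, fed `hdef h2`), F1a ★ `stubF1aCM_holds`) keep their `h2` texts.  PRINT-FAITHFULNESS (director s2043 (iii)): «`3 ≤ [F⁺:ℚ]` is implied by Hyp413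
(`6 ≤ [F:ℚ]`); the weakening costs nothing at the summit; anchor [Rogawski1990 §13.3 (13.3.6(c)), two compact places]» — the `3 ≤` clause is a ROUTE restriction of
the R90-TF road, not a hypothesis of Rogawski's theorems.
* §1 `stubE1coh₃_of_C1cot₃ : (∀ frame with h2 h3, C1♮) → StubE1coh₃`.
* §2 `betaOppAdmCot₃_of_C3sharp₃_of_rigidFin : (∀ frame with h2 h3, C3♯) → GUARDED U♭ → β_opp-adm-cot₃`.
* §3 `stubs_of_guardedEngine₃ (h : <v4 head, ₃ edition>) : StubE1coh₃ ∧ β_opp-adm-cot₃` (U♭ IN-HOUSE ★ `F0P3XiRigid.memXiFamily_rigid_cm`; (C2♯) carried, not used).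
* §4 `letters_of_guardedEngine₃ (h : <v4 head, ₃ edition>) : StubE1coh₃ ∧ HodgeTypeRigid₃` (E2′₃ via ★ (E-3a) `hodgeTypeRigid_of_betaOppAdmCot_cpt₃` with F1a IN-HOUSE
  ★ `stubF1aCM_holds`).  AGG's ₃ edition then reads `letters_of_rung0₃ := letters_of_specPkgV8W_cot₃ frameDataOfRung0 rows_of_rung0₃` (CENSUS-L7 §4).
References: as in ★ `F0P3GuardedLettersOfGuardedShape` ([Rogawski1990] §14.6 Thm. 14.6.4 (pp. 236–239; p. 244 ll. 6–17); §12.3 pp. 176–178 (Prop. 12.3.3);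
Thm. 13.3.6 (c); Prop. 15.2.1 (a), (b); §15.3 ¶1. [BorelWallach2000] VI Thm. 4.11. [BernsteinZelevinsky1977] Thm. 2.9. [BernsteinZelevinsky1976] §2.1.
[FlathCorvallis1979] Thm. 3. [BorelJacquet1979] §4.6).
-/

-- Mathlib idiom (as in ★ `GKModules`, ★ K1, ★ K1″, ★ B0): commutator bracket on `Module.End ℂ M`, to MENTION `(uFormGroup (Fin 2) (Fin 1)).lie →ₗ⁅ℝ⁆ Module.End ℂ M`
attribute [local instance 100] LieRing.ofAssociativeRing

set_option autoImplicit false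
-- the mandated namespace repeats `HodgeConjecture.HodgeConjecture`, as in every `Theorems/*.lean` of this sub-problem
set_option linter.dupNamespace false

noncomputable section

open NumberField IsDedekindDomain MeasureTheory
open scoped Matrix ComplexOrder

namespace Summit.HodgeConjecture.HodgeConjecture.Cruxes.H413.F0P3GuardedLettersOfGuardedShape3

open Literature.NumberTheory.Rogawski1990 Literature.NumberTheory.GaloisRepresentations
open Literature.NumberTheory.Automorphic Literature.NumberTheory.Automorphic.UnitaryGroup
open Literature.NumberTheory.Automorphic.UnitaryGroup.CotangentForms
open Literature.RepresentationTheory.BorelWallach2000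
open Literature.RepresentationTheory.KonnoKonno2007 Literature.RepresentationTheory.KonnoKonno2007.RealDualPair
open Literature.RepresentationTheory.KonnoKonno2007.RealDualPair.UForm
open Summit.HodgeConjecture.HodgeConjecture.Cruxes.H413.F0P3XiRigid (memXiFamily_rigid_cm)
open Summit.HodgeConjecture.HodgeConjecture.Cruxes.H413.F0P3HodgeTypeRigidOfBetaOppAdmCot (hodgeTypeRigid_of_betaOppAdmCot_cpt)
open Summit.HodgeConjecture.HodgeConjecture.Cruxes.H413.F0P3StubF1aCM (stubF1aCM_holds)
open Summit.HodgeConjecture.HodgeConjecture.Cruxes.H413.F0P3CompactTrivOfRecord (cmCompactFactor_rightRegular_eq_self_of_isHolOrAntihol)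
open Summit.HodgeConjecture.HodgeConjecture.Cruxes.H413.F0P3HodgeTypeRigidOfBetaOppAdmCot3 (hodgeTypeRigid_of_betaOppAdmCot_cpt₃)

/-! ## §1 `StubE1coh₃` from the v4 conjunct (C1♮) at frames with two compact places -/

/-- **`StubE1coh₃` from the (C1♮) conjunct, ₃ edition** (`m(P) ≤ 1` for every cotangent-type, `Kc`-trivial `P` carrying an `H¹`-token of type `±1` at `ι`, at
every compact CM frame with `3 ≤ [L⁺:ℚ]`): ★ `stubE1coh_of_C1cot`'s proof VERBATIM with `h3` introduced beside `h2` and passed at the ONE application of `hC1c`;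
the cotangent guard is `StubE1coh₃`'s own hypothesis, `Kc`-triviality follows from it (★ p819716 `cmCompactFactor_rightRegular_eq_self_of_isHolOrAntihol`), the
token is produced in-house (★ `exists_cohToken_of_isHolOrAntihol_cpt`, `h2` frame), the `μω` binders by ★ `exists_muOmega`.  Conclusion BY NAME: ★
`F0P3ThreadLetters3Defs.StubE1coh₃`.
[cite: Rogawski1990, §14.6 Thm. 14.6.4; Prop. 15.2.1 (b); §15.3 ¶1] [cite: BorelWallach2000, VI Thm. 4.11] [cite: BorelJacquet1979, §4.6] -/
theorem stubE1coh₃_of_C1cot₃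
    (hC1c :
    ∀ (L : Type) [Field L] [NumberField L] [IsCMField L] (ι : L →+* ℂ) (H : Matrix (Fin 3) (Fin 3) L) (T : GL (Fin 3) ℂ)
      (hT : (T : Matrix (Fin 3) (Fin 3) ℂ)ᴴ * H.map ι * (T : Matrix (Fin 3) (Fin 3) ℂ) = Literature.Geometry.ComplexHyperbolic.BallModel.J),
      (∀ τ' : L →+* ℂ, InfinitePlace.mk τ' ≠ InfinitePlace.mk ι → (H.map τ').PosDef) →
      2 ≤ Module.finrank ℚ ↥(maximalRealSubfield L) →
      3 ≤ Module.finrank ℚ ↥(maximalRealSubfield L) →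
      ∀ (μ : Measure (adelicGroupData (↥(maximalRealSubfield L)) L (IsCMField.complexConj L) 3 H).automorphicQuotient)
        [(adelicGroupData (↥(maximalRealSubfield L)) L (IsCMField.complexConj L) 3 H).IsAutomorphicMeasure μ]
        (μω : HeckeCharacter L) (hμu : μω.IsUnitary),
        (∀ x : Literature.NumberTheory.GaloisRepresentations.ideleGroup ↥(maximalRealSubfield L),
          μω (AdeleRing.ideleBaseChange (↥(maximalRealSubfield L)) L x) = quadraticHeckeCharCM L x) →
      ∀ (P : DiscreteAutomorphicRep (adelicGroupData (↥(maximalRealSubfield L)) L (IsCMField.complexConj L) 3 H) μ),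
          (P.IsHolCotangentAt (cmArchSection L ι H T hT) (cmCompactFactor L ι H T hT) ∨
            P.IsAntiholCotangentAt (cmArchSection L ι H T hT) (cmCompactFactor L ι H T hT)) →
          (∀ k : (adelicGroupData (↥(maximalRealSubfield L)) L (IsCMField.complexConj L) 3 H).Adelic, k ∈ cmCompactFactor L ι H T hT → ∀ v : P.space.toSubmodule, (adelicGroupData (↥(maximalRealSubfield L)) L (IsCMField.complexConj L) 3 H).rightRegular μ k (v : (adelicGroupData (↥(maximalRealSubfield L)) L (IsCMField.complexConj L) 3 H).L2 μ) = v) → ∀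
          (M : Type) [AddCommGroup M] [Module ℂ M]
          (σK : Representation ℂ (uFormGroup (Fin 2) (Fin 1)).maximalCompact M) (σ𝔤 : (uFormGroup (Fin 2) (Fin 1)).lie →ₗ⁅ℝ⁆ Module.End ℂ M)
          (hM : IsGKModule (uFormGroup (Fin 2) (Fin 1)) σK σ𝔤), IsIrreducibleGK σK σ𝔤 →
          (∃ T₁ : P.archModuleCM ι T hT →ₗ[ℂ] M,
            (∀ (k : (uFormGroup (Fin 2) (Fin 1)).maximalCompact) (w : P.archModuleCM ι T hT), T₁ (P.archRepKCM ι T hT k w) = σK k (T₁ w)) ∧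
              (∀ (X : (uFormGroup (Fin 2) (Fin 1)).lie) (w : P.archModuleCM ι T hT), T₁ (P.archRepLieCM ι T hT X w) = σ𝔤 X (T₁ w)) ∧ T₁ ≠ 0) →
          ∀ δ : ℤ, (δ = 1 ∨ δ = -1) → upqTypeClasses σK σ𝔤 hM.ad_compat 1 δ ≠ ⊥ →
            ((adelicGroupData (↥(maximalRealSubfield L)) L (IsCMField.complexConj L) 3 H).rightRegular μ).multiplicity P.space.toContRep ≤ 1) :
    F0P3ThreadLetters3Defs.StubE1coh₃ := by
  intro L _ _ _ ι H T hT hdef h2 h3 μ _ P hP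
  obtain ⟨μω, hμu, hμω⟩ := F0P3MemXiFamilyTransfer.exists_muOmega L
  have hKc := cmCompactFactor_rightRegular_eq_self_of_isHolOrAntihol L ι H T hT P hP
  obtain ⟨M, _, _, σK, σ𝔤, hM, δ, hδ, hirr, hT₁, hne⟩ :=
    F0P3SLayerFoldShapes.exists_cohToken_of_isHolOrAntihol_cpt L ι H T hT μ hdef h2 P hP
  exact hC1c L ι H T hT hdef h2 h3 μ μω hμu hμω P hP hKc M σK σ𝔤 hM hirr hT₁ δ hδ hne

/-! ## §2 β_opp-adm-cot₃ from the v4 conjunct (C3♯) at frames with two compact places + GUARDED U♭ -/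

/-- **β_opp-adm-cot₃ ⇐ (C3♯)₃ + GUARDED U♭** — ★ `betaOppAdmCot_of_C3sharp_of_rigidFin`'s proof VERBATIM with `h3` introduced beside `h2` and passed at the ONE
application of `hC3c`; the cotangent guards of `P`, `P′` and their `Kc`-triviality (★ p819716) threaded into (C3♯), the archimedean pin discarded: `sgn ξ = 1`
from `P`'s type-`(+1)` token, `sgn ξ′ = −1` from `P′`'s type-`(−1)` token, `MemXiFamily P′ ξ` by the in-house transfer ★ T♭ `memXiFamily_transfer_cm` along the
common admissible `σ`, `ξ = ξ′` by U♭ at `P′` (text `hUσ` VERBATIM, `h2` frame); `1 = −1` is absurd.  Conclusion = the β_opp-adm-cot text + ONE `3 ≤ [L⁺:ℚ]` line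
(= the `hβc` text of ★ `F0P3HodgeTypeRigidOfBetaOppAdmCot3.hodgeTypeRigid_of_betaOppAdmCot_cpt₃`, token for token).
[cite: Rogawski1990, Thm. 13.3.6 (c); §14.6 Thm. 14.6.4; §12.3 p. 178; Prop. 15.2.1 (a), (b)] [cite: BernsteinZelevinsky1976, §2.1] [cite: BernsteinZelevinsky1977, Thm. 2.9] -/
theorem betaOppAdmCot₃_of_C3sharp₃_of_rigidFin
    (hC3c :
    ∀ (L : Type) [Field L] [NumberField L] [IsCMField L] (ι : L →+* ℂ) (H : Matrix (Fin 3) (Fin 3) L) (T : GL (Fin 3) ℂ)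
      (hT : (T : Matrix (Fin 3) (Fin 3) ℂ)ᴴ * H.map ι * (T : Matrix (Fin 3) (Fin 3) ℂ) = Literature.Geometry.ComplexHyperbolic.BallModel.J),
      (∀ τ' : L →+* ℂ, InfinitePlace.mk τ' ≠ InfinitePlace.mk ι → (H.map τ').PosDef) →
      2 ≤ Module.finrank ℚ ↥(maximalRealSubfield L) →
      3 ≤ Module.finrank ℚ ↥(maximalRealSubfield L) →
      ∀ (μ : Measure (adelicGroupData (↥(maximalRealSubfield L)) L (IsCMField.complexConj L) 3 H).automorphicQuotient)
        [(adelicGroupData (↥(maximalRealSubfield L)) L (IsCMField.complexConj L) 3 H).IsAutomorphicMeasure μ]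
        (μω : HeckeCharacter L) (hμu : μω.IsUnitary),
        (∀ x : Literature.NumberTheory.GaloisRepresentations.ideleGroup ↥(maximalRealSubfield L),
          μω (AdeleRing.ideleBaseChange (↥(maximalRealSubfield L)) L x) = quadraticHeckeCharCM L x) →
      ∃ sgn : OneDimAutRepH L → ℤ, ∀ (P : DiscreteAutomorphicRep (adelicGroupData (↥(maximalRealSubfield L)) L (IsCMField.complexConj L) 3 H) μ),
          (P.IsHolCotangentAt (cmArchSection L ι H T hT) (cmCompactFactor L ι H T hT) ∨
            P.IsAntiholCotangentAt (cmArchSection L ι H T hT) (cmCompactFactor L ι H T hT)) →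
          (∀ k : (adelicGroupData (↥(maximalRealSubfield L)) L (IsCMField.complexConj L) 3 H).Adelic, k ∈ cmCompactFactor L ι H T hT → ∀ v : P.space.toSubmodule, (adelicGroupData (↥(maximalRealSubfield L)) L (IsCMField.complexConj L) 3 H).rightRegular μ k (v : (adelicGroupData (↥(maximalRealSubfield L)) L (IsCMField.complexConj L) 3 H).L2 μ) = v) → ∀
          (M : Type) [AddCommGroup M] [Module ℂ M]
          (σK : Representation ℂ (uFormGroup (Fin 2) (Fin 1)).maximalCompact M) (σ𝔤 : (uFormGroup (Fin 2) (Fin 1)).lie →ₗ⁅ℝ⁆ Module.End ℂ M)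
          (hM : IsGKModule (uFormGroup (Fin 2) (Fin 1)) σK σ𝔤), IsIrreducibleGK σK σ𝔤 →
          (∃ T₁ : P.archModuleCM ι T hT →ₗ[ℂ] M,
            (∀ (k : (uFormGroup (Fin 2) (Fin 1)).maximalCompact) (w : P.archModuleCM ι T hT), T₁ (P.archRepKCM ι T hT k w) = σK k (T₁ w)) ∧
              (∀ (X : (uFormGroup (Fin 2) (Fin 1)).lie) (w : P.archModuleCM ι T hT), T₁ (P.archRepLieCM ι T hT X w) = σ𝔤 X (T₁ w)) ∧ T₁ ≠ 0) →
          ∀ δ : ℤ, (δ = 1 ∨ δ = -1) → upqTypeClasses σK σ𝔤 hM.ad_compat 1 δ ≠ ⊥ →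
            ∃ ξ : OneDimAutRepH L, MemXiFamily P (transpose_map_cmConjRingHom_eq_of_frame L ι H T hT) (isUnit_det_of_frame L ι H T hT) μω hμu ξ ∧ δ = sgn ξ ∧
              ∀ k : InfinitePlace L → ℤ, μω.HasUnitaryArchType k (fun _ => 0) → ∀ ι' : L →+* ℂ, ξ.IsCohTrivialAt (ArchSignRecipe.tOfArchType k ι') ι')
    (hUσ :
    ∀ (L : Type) [Field L] [NumberField L] [IsCMField L] (ι : L →+* ℂ) (H : Matrix (Fin 3) (Fin 3) L) (T : GL (Fin 3) ℂ)
      (hT : (T : Matrix (Fin 3) (Fin 3) ℂ)ᴴ * H.map ι * (T : Matrix (Fin 3) (Fin 3) ℂ) = Literature.Geometry.ComplexHyperbolic.BallModel.J),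
      (∀ τ' : L →+* ℂ, InfinitePlace.mk τ' ≠ InfinitePlace.mk ι → (H.map τ').PosDef) →
      2 ≤ Module.finrank ℚ ↥(maximalRealSubfield L) →
      ∀ (μ : Measure (adelicGroupData (↥(maximalRealSubfield L)) L (IsCMField.complexConj L) 3 H).automorphicQuotient)
        [(adelicGroupData (↥(maximalRealSubfield L)) L (IsCMField.complexConj L) 3 H).IsAutomorphicMeasure μ]
        (μω : HeckeCharacter L) (hμu : μω.IsUnitary),
        (∀ x : Literature.NumberTheory.GaloisRepresentations.ideleGroup ↥(maximalRealSubfield L),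
          μω (AdeleRing.ideleBaseChange (↥(maximalRealSubfield L)) L x) = quadraticHeckeCharCM L x) →
      ∀ (P : DiscreteAutomorphicRep (adelicGroupData (↥(maximalRealSubfield L)) L (IsCMField.complexConj L) 3 H) μ)
        (W : Type) [AddCommGroup W] [Module ℂ W]
        (σ : Representation ℂ (finAdelic (↥(maximalRealSubfield L)) L (IsCMField.complexConj L) 3 H) W),
        σ.IsIrreducible → σ.IsSmooth → P.HasFinComponent σ →
        ∀ (ξ ξ' : OneDimAutRepH L), MemXiFamily P (transpose_map_cmConjRingHom_eq_of_frame L ι H T hT) (isUnit_det_of_frame L ι H T hT) μω hμu ξ → MemXiFamily P (transpose_map_cmConjRingHom_eq_of_frame L ι H T hT) (isUnit_det_of_frame L ι H T hT) μω hμu ξ' → ξ = ξ') :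
    ∀ (L : Type) [Field L] [NumberField L] [IsCMField L] (ι : L →+* ℂ) (H : Matrix (Fin 3) (Fin 3) L) (T : GL (Fin 3) ℂ)
      (hT : (T : Matrix (Fin 3) (Fin 3) ℂ)ᴴ * H.map ι * (T : Matrix (Fin 3) (Fin 3) ℂ) = Literature.Geometry.ComplexHyperbolic.BallModel.J),
      (∀ τ' : L →+* ℂ, InfinitePlace.mk τ' ≠ InfinitePlace.mk ι → (H.map τ').PosDef) →
      2 ≤ Module.finrank ℚ ↥(maximalRealSubfield L) →
      3 ≤ Module.finrank ℚ ↥(maximalRealSubfield L) →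
      ∀ (μ : Measure (adelicGroupData (↥(maximalRealSubfield L)) L (IsCMField.complexConj L) 3 H).automorphicQuotient)
        [(adelicGroupData (↥(maximalRealSubfield L)) L (IsCMField.complexConj L) 3 H).IsAutomorphicMeasure μ]
        (W : Type) [AddCommGroup W] [Module ℂ W]
        (σ : Representation ℂ (finAdelic (↥(maximalRealSubfield L)) L (IsCMField.complexConj L) 3 H) W),
        σ.IsIrreducible → σ.IsSmooth → σ.IsAdmissible →
      ∀ (P P' : DiscreteAutomorphicRep (adelicGroupData (↥(maximalRealSubfield L)) L (IsCMField.complexConj L) 3 H) μ),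
        (P.IsHolCotangentAt (cmArchSection L ι H T hT) (cmCompactFactor L ι H T hT) ∨
          P.IsAntiholCotangentAt (cmArchSection L ι H T hT) (cmCompactFactor L ι H T hT)) →
        (P'.IsHolCotangentAt (cmArchSection L ι H T hT) (cmCompactFactor L ι H T hT) ∨
          P'.IsAntiholCotangentAt (cmArchSection L ι H T hT) (cmCompactFactor L ι H T hT)) →
        P.HasFinComponent σ → P'.HasFinComponent σ →
      ∀ (M : Type) [AddCommGroup M] [Module ℂ M] (σK : Representation ℂ (uFormGroup (Fin 2) (Fin 1)).maximalCompact M)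
        (σ𝔤 : (uFormGroup (Fin 2) (Fin 1)).lie →ₗ⁅ℝ⁆ Module.End ℂ M) (hM : IsGKModule (uFormGroup (Fin 2) (Fin 1)) σK σ𝔤),
        IsIrreducibleGK σK σ𝔤 →
        (∃ T₁ : P.archModuleCM ι T hT →ₗ[ℂ] M,
          (∀ (k : (uFormGroup (Fin 2) (Fin 1)).maximalCompact) (w : P.archModuleCM ι T hT),
              T₁ (P.archRepKCM ι T hT k w) = σK k (T₁ w)) ∧
            (∀ (X : (uFormGroup (Fin 2) (Fin 1)).lie) (w : P.archModuleCM ι T hT),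
              T₁ (P.archRepLieCM ι T hT X w) = σ𝔤 X (T₁ w)) ∧ T₁ ≠ 0) →
      ∀ (M' : Type) [AddCommGroup M'] [Module ℂ M'] (σK' : Representation ℂ (uFormGroup (Fin 2) (Fin 1)).maximalCompact M')
        (σ𝔤' : (uFormGroup (Fin 2) (Fin 1)).lie →ₗ⁅ℝ⁆ Module.End ℂ M') (hM' : IsGKModule (uFormGroup (Fin 2) (Fin 1)) σK' σ𝔤'),
        IsIrreducibleGK σK' σ𝔤' →
        (∃ T₂ : P'.archModuleCM ι T hT →ₗ[ℂ] M',
          (∀ (k : (uFormGroup (Fin 2) (Fin 1)).maximalCompact) (w : P'.archModuleCM ι T hT),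
              T₂ (P'.archRepKCM ι T hT k w) = σK' k (T₂ w)) ∧
            (∀ (X : (uFormGroup (Fin 2) (Fin 1)).lie) (w : P'.archModuleCM ι T hT),
              T₂ (P'.archRepLieCM ι T hT X w) = σ𝔤' X (T₂ w)) ∧ T₂ ≠ 0) →
        upqTypeClasses σK σ𝔤 hM.ad_compat 1 1 ≠ ⊥ → upqTypeClasses σK' σ𝔤' hM'.ad_compat 1 (-1) ≠ ⊥ → False := by
  intro L _ _ _ ι H T hT hdef h2 h3 μ _ W _ _ σ hσi hσs hσa P P' hPc hP'c hPσ hP'σ M _ _ σK σ𝔤 hM hirr hT₁ M' _ _ σK' σ𝔤' hM' hirr' hT₂ hne hne'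
  obtain ⟨μω, hμu, hμω⟩ := F0P3MemXiFamilyTransfer.exists_muOmega L
  obtain ⟨sgn, hsgn⟩ := hC3c L ι H T hT hdef h2 h3 μ μω hμu hμω
  have hKc := cmCompactFactor_rightRegular_eq_self_of_isHolOrAntihol L ι H T hT P hPc
  have hKc' := cmCompactFactor_rightRegular_eq_self_of_isHolOrAntihol L ι H T hT P' hP'c
  obtain ⟨ξ, hP, h1, -⟩ := hsgn P hPc hKc M σK σ𝔤 hM hirr hT₁ 1 (Or.inl rfl) hne
  obtain ⟨ξ', hP', h2', -⟩ := hsgn P' hP'c hKc' M' σK' σ𝔤' hM' hirr' hT₂ (-1) (Or.inr rfl) hne'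
  have hP'ξ := F0P3MemXiFamilyTransfer.memXiFamily_transfer_cm L ι H T hT μ μω hμu W σ hσi hσs hσa P P' ξ hPσ hP'σ hP
  have hξ : ξ = ξ' := hUσ L ι H T hT hdef h2 μ μω hμu hμω P' W σ hσi hσs hP'σ ξ ξ' hP'ξ hP'
  rw [hξ] at h1
  omega

/-! ## §3 THE v4 HEAD AT FRAMES WITH TWO COMPACT PLACES ⇒ `StubE1coh₃` ∧ β_opp-adm-cot₃ (U♭ IN-HOUSE) -/

/-- **`stubs_of_guardedEngine₃`: the v4 head `∀ compact CM frame with 3 ≤ [L⁺:ℚ], (C1♮) ∧ (C2♯) ∧ (C3♯)` (text of ★-to-be `shapeGuarded₃_of_T5`'s conclusion = ★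
`shapeGuarded_of_T5`'s conclusion V8 :227–:273 + ONE inserted `3 ≤ …` line after the kept `2 ≤ …` line) ⇒ `StubE1coh₃` ∧ β_opp-adm-cot₃**, with family rigidity U♭
IN-HOUSE (★ `F0P3XiRigid.memXiFamily_rigid_cm`); (C2♯) is carried and not used.  ★ `stubs_of_guardedEngine` VERBATIM with `h3` threaded through the two projections.
[cite: Rogawski1990, §14.6 Thm. 14.6.4; §12.3 p. 178; Prop. 15.2.1 (a), (b)] -/
theorem stubs_of_guardedEngine₃
    (h :
    ∀ (L : Type) [Field L] [NumberField L] [IsCMField L] (ι : L →+* ℂ) (H : Matrix (Fin 3) (Fin 3) L) (T : GL (Fin 3) ℂ)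
      (hT : (T : Matrix (Fin 3) (Fin 3) ℂ)ᴴ * H.map ι * (T : Matrix (Fin 3) (Fin 3) ℂ) = Literature.Geometry.ComplexHyperbolic.BallModel.J),
      (∀ τ' : L →+* ℂ, InfinitePlace.mk τ' ≠ InfinitePlace.mk ι → (H.map τ').PosDef) →
      2 ≤ Module.finrank ℚ ↥(maximalRealSubfield L) →
      3 ≤ Module.finrank ℚ ↥(maximalRealSubfield L) →
      ∀ (μ : Measure (adelicGroupData (↥(maximalRealSubfield L)) L (IsCMField.complexConj L) 3 H).automorphicQuotient)
        [(adelicGroupData (↥(maximalRealSubfield L)) L (IsCMField.complexConj L) 3 H).IsAutomorphicMeasure μ]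
        (μω : HeckeCharacter L) (hμu : μω.IsUnitary),
        (∀ x : Literature.NumberTheory.GaloisRepresentations.ideleGroup ↥(maximalRealSubfield L),
          μω (AdeleRing.ideleBaseChange (↥(maximalRealSubfield L)) L x) = quadraticHeckeCharCM L x) →
      (∀ (P : DiscreteAutomorphicRep (adelicGroupData (↥(maximalRealSubfield L)) L (IsCMField.complexConj L) 3 H) μ),
          (P.IsHolCotangentAt (cmArchSection L ι H T hT) (cmCompactFactor L ι H T hT) ∨
            P.IsAntiholCotangentAt (cmArchSection L ι H T hT) (cmCompactFactor L ι H T hT)) →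
          (∀ k : (adelicGroupData (↥(maximalRealSubfield L)) L (IsCMField.complexConj L) 3 H).Adelic, k ∈ cmCompactFactor L ι H T hT → ∀ v : P.space.toSubmodule, (adelicGroupData (↥(maximalRealSubfield L)) L (IsCMField.complexConj L) 3 H).rightRegular μ k (v : (adelicGroupData (↥(maximalRealSubfield L)) L (IsCMField.complexConj L) 3 H).L2 μ) = v) → ∀
          (M : Type) [AddCommGroup M] [Module ℂ M]
          (σK : Representation ℂ (uFormGroup (Fin 2) (Fin 1)).maximalCompact M) (σ𝔤 : (uFormGroup (Fin 2) (Fin 1)).lie →ₗ⁅ℝ⁆ Module.End ℂ M)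
          (hM : IsGKModule (uFormGroup (Fin 2) (Fin 1)) σK σ𝔤), IsIrreducibleGK σK σ𝔤 →
          (∃ T₁ : P.archModuleCM ι T hT →ₗ[ℂ] M,
            (∀ (k : (uFormGroup (Fin 2) (Fin 1)).maximalCompact) (w : P.archModuleCM ι T hT), T₁ (P.archRepKCM ι T hT k w) = σK k (T₁ w)) ∧
              (∀ (X : (uFormGroup (Fin 2) (Fin 1)).lie) (w : P.archModuleCM ι T hT), T₁ (P.archRepLieCM ι T hT X w) = σ𝔤 X (T₁ w)) ∧ T₁ ≠ 0) →
          ∀ δ : ℤ, (δ = 1 ∨ δ = -1) → upqTypeClasses σK σ𝔤 hM.ad_compat 1 δ ≠ ⊥ →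
            ((adelicGroupData (↥(maximalRealSubfield L)) L (IsCMField.complexConj L) 3 H).rightRegular μ).multiplicity P.space.toContRep ≤ 1) ∧
      (∀ (P : DiscreteAutomorphicRep (adelicGroupData (↥(maximalRealSubfield L)) L (IsCMField.complexConj L) 3 H) μ),
          (P.IsHolCotangentAt (cmArchSection L ι H T hT) (cmCompactFactor L ι H T hT) ∨
            P.IsAntiholCotangentAt (cmArchSection L ι H T hT) (cmCompactFactor L ι H T hT)) →
          (∀ k : (adelicGroupData (↥(maximalRealSubfield L)) L (IsCMField.complexConj L) 3 H).Adelic, k ∈ cmCompactFactor L ι H T hT → ∀ v : P.space.toSubmodule, (adelicGroupData (↥(maximalRealSubfield L)) L (IsCMField.complexConj L) 3 H).rightRegular μ k (v : (adelicGroupData (↥(maximalRealSubfield L)) L (IsCMField.complexConj L) 3 H).L2 μ) = v) → ∀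
          (M : Type) [AddCommGroup M] [Module ℂ M]
          (σK : Representation ℂ (uFormGroup (Fin 2) (Fin 1)).maximalCompact M) (σ𝔤 : (uFormGroup (Fin 2) (Fin 1)).lie →ₗ⁅ℝ⁆ Module.End ℂ M)
          (hM : IsGKModule (uFormGroup (Fin 2) (Fin 1)) σK σ𝔤), IsIrreducibleGK σK σ𝔤 →
          (∃ T₁ : P.archModuleCM ι T hT →ₗ[ℂ] M,
            (∀ (k : (uFormGroup (Fin 2) (Fin 1)).maximalCompact) (w : P.archModuleCM ι T hT), T₁ (P.archRepKCM ι T hT k w) = σK k (T₁ w)) ∧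
              (∀ (X : (uFormGroup (Fin 2) (Fin 1)).lie) (w : P.archModuleCM ι T hT), T₁ (P.archRepLieCM ι T hT X w) = σ𝔤 X (T₁ w)) ∧ T₁ ≠ 0) →
          ∀ δ : ℤ, (δ = 1 ∨ δ = -1) → upqTypeClasses σK σ𝔤 hM.ad_compat 1 δ ≠ ⊥ →
            ∃ ξ : OneDimAutRepH L, MemXiFamily P (transpose_map_cmConjRingHom_eq_of_frame L ι H T hT) (isUnit_det_of_frame L ι H T hT) μω hμu ξ ∧
              ∀ k : InfinitePlace L → ℤ, μω.HasUnitaryArchType k (fun _ => 0) → ∀ ι' : L →+* ℂ, ξ.IsCohTrivialAt (ArchSignRecipe.tOfArchType k ι') ι') ∧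
      (∃ sgn : OneDimAutRepH L → ℤ, ∀ (P : DiscreteAutomorphicRep (adelicGroupData (↥(maximalRealSubfield L)) L (IsCMField.complexConj L) 3 H) μ),
          (P.IsHolCotangentAt (cmArchSection L ι H T hT) (cmCompactFactor L ι H T hT) ∨
            P.IsAntiholCotangentAt (cmArchSection L ι H T hT) (cmCompactFactor L ι H T hT)) →
          (∀ k : (adelicGroupData (↥(maximalRealSubfield L)) L (IsCMField.complexConj L) 3 H).Adelic, k ∈ cmCompactFactor L ι H T hT → ∀ v : P.space.toSubmodule, (adelicGroupData (↥(maximalRealSubfield L)) L (IsCMField.complexConj L) 3 H).rightRegular μ k (v : (adelicGroupData (↥(maximalRealSubfield L)) L (IsCMField.complexConj L) 3 H).L2 μ) = v) → ∀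
          (M : Type) [AddCommGroup M] [Module ℂ M]
          (σK : Representation ℂ (uFormGroup (Fin 2) (Fin 1)).maximalCompact M) (σ𝔤 : (uFormGroup (Fin 2) (Fin 1)).lie →ₗ⁅ℝ⁆ Module.End ℂ M)
          (hM : IsGKModule (uFormGroup (Fin 2) (Fin 1)) σK σ𝔤), IsIrreducibleGK σK σ𝔤 →
          (∃ T₁ : P.archModuleCM ι T hT →ₗ[ℂ] M,
            (∀ (k : (uFormGroup (Fin 2) (Fin 1)).maximalCompact) (w : P.archModuleCM ι T hT), T₁ (P.archRepKCM ι T hT k w) = σK k (T₁ w)) ∧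
              (∀ (X : (uFormGroup (Fin 2) (Fin 1)).lie) (w : P.archModuleCM ι T hT), T₁ (P.archRepLieCM ι T hT X w) = σ𝔤 X (T₁ w)) ∧ T₁ ≠ 0) →
          ∀ δ : ℤ, (δ = 1 ∨ δ = -1) → upqTypeClasses σK σ𝔤 hM.ad_compat 1 δ ≠ ⊥ →
            ∃ ξ : OneDimAutRepH L, MemXiFamily P (transpose_map_cmConjRingHom_eq_of_frame L ι H T hT) (isUnit_det_of_frame L ι H T hT) μω hμu ξ ∧ δ = sgn ξ ∧
              ∀ k : InfinitePlace L → ℤ, μω.HasUnitaryArchType k (fun _ => 0) → ∀ ι' : L →+* ℂ, ξ.IsCohTrivialAt (ArchSignRecipe.tOfArchType k ι') ι')) :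
    F0P3ThreadLetters3Defs.StubE1coh₃ ∧
    (∀ (L : Type) [Field L] [NumberField L] [IsCMField L] (ι : L →+* ℂ) (H : Matrix (Fin 3) (Fin 3) L) (T : GL (Fin 3) ℂ)
      (hT : (T : Matrix (Fin 3) (Fin 3) ℂ)ᴴ * H.map ι * (T : Matrix (Fin 3) (Fin 3) ℂ) = Literature.Geometry.ComplexHyperbolic.BallModel.J),
      (∀ τ' : L →+* ℂ, InfinitePlace.mk τ' ≠ InfinitePlace.mk ι → (H.map τ').PosDef) →
      2 ≤ Module.finrank ℚ ↥(maximalRealSubfield L) →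
      3 ≤ Module.finrank ℚ ↥(maximalRealSubfield L) →
      ∀ (μ : Measure (adelicGroupData (↥(maximalRealSubfield L)) L (IsCMField.complexConj L) 3 H).automorphicQuotient)
        [(adelicGroupData (↥(maximalRealSubfield L)) L (IsCMField.complexConj L) 3 H).IsAutomorphicMeasure μ]
        (W : Type) [AddCommGroup W] [Module ℂ W]
        (σ : Representation ℂ (finAdelic (↥(maximalRealSubfield L)) L (IsCMField.complexConj L) 3 H) W),
        σ.IsIrreducible → σ.IsSmooth → σ.IsAdmissible →
      ∀ (P P' : DiscreteAutomorphicRep (adelicGroupData (↥(maximalRealSubfield L)) L (IsCMField.complexConj L) 3 H) μ),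
        (P.IsHolCotangentAt (cmArchSection L ι H T hT) (cmCompactFactor L ι H T hT) ∨
          P.IsAntiholCotangentAt (cmArchSection L ι H T hT) (cmCompactFactor L ι H T hT)) →
        (P'.IsHolCotangentAt (cmArchSection L ι H T hT) (cmCompactFactor L ι H T hT) ∨
          P'.IsAntiholCotangentAt (cmArchSection L ι H T hT) (cmCompactFactor L ι H T hT)) →
        P.HasFinComponent σ → P'.HasFinComponent σ →
      ∀ (M : Type) [AddCommGroup M] [Module ℂ M] (σK : Representation ℂ (uFormGroup (Fin 2) (Fin 1)).maximalCompact M)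
        (σ𝔤 : (uFormGroup (Fin 2) (Fin 1)).lie →ₗ⁅ℝ⁆ Module.End ℂ M) (hM : IsGKModule (uFormGroup (Fin 2) (Fin 1)) σK σ𝔤),
        IsIrreducibleGK σK σ𝔤 →
        (∃ T₁ : P.archModuleCM ι T hT →ₗ[ℂ] M,
          (∀ (k : (uFormGroup (Fin 2) (Fin 1)).maximalCompact) (w : P.archModuleCM ι T hT),
              T₁ (P.archRepKCM ι T hT k w) = σK k (T₁ w)) ∧
            (∀ (X : (uFormGroup (Fin 2) (Fin 1)).lie) (w : P.archModuleCM ι T hT),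
              T₁ (P.archRepLieCM ι T hT X w) = σ𝔤 X (T₁ w)) ∧ T₁ ≠ 0) →
      ∀ (M' : Type) [AddCommGroup M'] [Module ℂ M'] (σK' : Representation ℂ (uFormGroup (Fin 2) (Fin 1)).maximalCompact M')
        (σ𝔤' : (uFormGroup (Fin 2) (Fin 1)).lie →ₗ⁅ℝ⁆ Module.End ℂ M') (hM' : IsGKModule (uFormGroup (Fin 2) (Fin 1)) σK' σ𝔤'),
        IsIrreducibleGK σK' σ𝔤' →
        (∃ T₂ : P'.archModuleCM ι T hT →ₗ[ℂ] M',
          (∀ (k : (uFormGroup (Fin 2) (Fin 1)).maximalCompact) (w : P'.archModuleCM ι T hT),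
              T₂ (P'.archRepKCM ι T hT k w) = σK' k (T₂ w)) ∧
            (∀ (X : (uFormGroup (Fin 2) (Fin 1)).lie) (w : P'.archModuleCM ι T hT),
              T₂ (P'.archRepLieCM ι T hT X w) = σ𝔤' X (T₂ w)) ∧ T₂ ≠ 0) →
        upqTypeClasses σK σ𝔤 hM.ad_compat 1 1 ≠ ⊥ → upqTypeClasses σK' σ𝔤' hM'.ad_compat 1 (-1) ≠ ⊥ → False) :=
  ⟨stubE1coh₃_of_C1cot₃ fun L _ _ _ ι H T hT hdef h2 h3 μ _ μω hμu hμω => (h L ι H T hT hdef h2 h3 μ μω hμu hμω).1,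
    betaOppAdmCot₃_of_C3sharp₃_of_rigidFin (fun L _ _ _ ι H T hT hdef h2 h3 μ _ μω hμu hμω => (h L ι H T hT hdef h2 h3 μ μω hμu hμω).2.2) memXiFamily_rigid_cm⟩

/-! ## §4 … and the LETTERS at frames with two compact places: `StubE1coh₃` ∧ E2′₃ `HodgeTypeRigid₃` (F1a IN-HOUSE) -/

/-- **`letters_of_guardedEngine₃`: the v4 head, ₃ edition ⇒ ★ `F0P3ThreadLetters3Defs.StubE1coh₃` ∧ ★ `F0P3ThreadLetters3Defs.HodgeTypeRigid₃`** (§3, then ★ (E-3a)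
`hodgeTypeRigid_of_betaOppAdmCot_cpt₃` with F1a IN-HOUSE ★ `stubF1aCM_holds`).  The input of ★-to-be (E-1) `letters_of_kitFamilyOfRecordV8W₃`; together with ★
`F0P3StubE1hFold3.stubE1hFold_holds_coh_cpt₃`, ★ `stubF1bCM_holds`, ★ (D)h, ★ (E)h this is every input of ★-to-be `F0P3HJ3aOfLettersCoh3.hJ3a_of_five_letters_coh₃`.
[cite: Rogawski1990, §14.6 Thm. 14.6.4; Thm. 13.3.6 (c); §12.3 p. 178; §15.3 ¶1] [cite: FlathCorvallis1979, Thm. 3 and Thm. 4] -/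
theorem letters_of_guardedEngine₃
    (h :
    ∀ (L : Type) [Field L] [NumberField L] [IsCMField L] (ι : L →+* ℂ) (H : Matrix (Fin 3) (Fin 3) L) (T : GL (Fin 3) ℂ)
      (hT : (T : Matrix (Fin 3) (Fin 3) ℂ)ᴴ * H.map ι * (T : Matrix (Fin 3) (Fin 3) ℂ) = Literature.Geometry.ComplexHyperbolic.BallModel.J),
      (∀ τ' : L →+* ℂ, InfinitePlace.mk τ' ≠ InfinitePlace.mk ι → (H.map τ').PosDef) →
      2 ≤ Module.finrank ℚ ↥(maximalRealSubfield L) →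
      3 ≤ Module.finrank ℚ ↥(maximalRealSubfield L) →
      ∀ (μ : Measure (adelicGroupData (↥(maximalRealSubfield L)) L (IsCMField.complexConj L) 3 H).automorphicQuotient)
        [(adelicGroupData (↥(maximalRealSubfield L)) L (IsCMField.complexConj L) 3 H).IsAutomorphicMeasure μ]
        (μω : HeckeCharacter L) (hμu : μω.IsUnitary),
        (∀ x : Literature.NumberTheory.GaloisRepresentations.ideleGroup ↥(maximalRealSubfield L),
          μω (AdeleRing.ideleBaseChange (↥(maximalRealSubfield L)) L x) = quadraticHeckeCharCM L x) →
      (∀ (P : DiscreteAutomorphicRep (adelicGroupData (↥(maximalRealSubfield L)) L (IsCMField.complexConj L) 3 H) μ),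
          (P.IsHolCotangentAt (cmArchSection L ι H T hT) (cmCompactFactor L ι H T hT) ∨
            P.IsAntiholCotangentAt (cmArchSection L ι H T hT) (cmCompactFactor L ι H T hT)) →
          (∀ k : (adelicGroupData (↥(maximalRealSubfield L)) L (IsCMField.complexConj L) 3 H).Adelic, k ∈ cmCompactFactor L ι H T hT → ∀ v : P.space.toSubmodule, (adelicGroupData (↥(maximalRealSubfield L)) L (IsCMField.complexConj L) 3 H).rightRegular μ k (v : (adelicGroupData (↥(maximalRealSubfield L)) L (IsCMField.complexConj L) 3 H).L2 μ) = v) → ∀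
          (M : Type) [AddCommGroup M] [Module ℂ M]
          (σK : Representation ℂ (uFormGroup (Fin 2) (Fin 1)).maximalCompact M) (σ𝔤 : (uFormGroup (Fin 2) (Fin 1)).lie →ₗ⁅ℝ⁆ Module.End ℂ M)
          (hM : IsGKModule (uFormGroup (Fin 2) (Fin 1)) σK σ𝔤), IsIrreducibleGK σK σ𝔤 →
          (∃ T₁ : P.archModuleCM ι T hT →ₗ[ℂ] M,
            (∀ (k : (uFormGroup (Fin 2) (Fin 1)).maximalCompact) (w : P.archModuleCM ι T hT), T₁ (P.archRepKCM ι T hT k w) = σK k (T₁ w)) ∧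
              (∀ (X : (uFormGroup (Fin 2) (Fin 1)).lie) (w : P.archModuleCM ι T hT), T₁ (P.archRepLieCM ι T hT X w) = σ𝔤 X (T₁ w)) ∧ T₁ ≠ 0) →
          ∀ δ : ℤ, (δ = 1 ∨ δ = -1) → upqTypeClasses σK σ𝔤 hM.ad_compat 1 δ ≠ ⊥ →
            ((adelicGroupData (↥(maximalRealSubfield L)) L (IsCMField.complexConj L) 3 H).rightRegular μ).multiplicity P.space.toContRep ≤ 1) ∧
      (∀ (P : DiscreteAutomorphicRep (adelicGroupData (↥(maximalRealSubfield L)) L (IsCMField.complexConj L) 3 H) μ),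
          (P.IsHolCotangentAt (cmArchSection L ι H T hT) (cmCompactFactor L ι H T hT) ∨
            P.IsAntiholCotangentAt (cmArchSection L ι H T hT) (cmCompactFactor L ι H T hT)) →
          (∀ k : (adelicGroupData (↥(maximalRealSubfield L)) L (IsCMField.complexConj L) 3 H).Adelic, k ∈ cmCompactFactor L ι H T hT → ∀ v : P.space.toSubmodule, (adelicGroupData (↥(maximalRealSubfield L)) L (IsCMField.complexConj L) 3 H).rightRegular μ k (v : (adelicGroupData (↥(maximalRealSubfield L)) L (IsCMField.complexConj L) 3 H).L2 μ) = v) → ∀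
          (M : Type) [AddCommGroup M] [Module ℂ M]
          (σK : Representation ℂ (uFormGroup (Fin 2) (Fin 1)).maximalCompact M) (σ𝔤 : (uFormGroup (Fin 2) (Fin 1)).lie →ₗ⁅ℝ⁆ Module.End ℂ M)
          (hM : IsGKModule (uFormGroup (Fin 2) (Fin 1)) σK σ𝔤), IsIrreducibleGK σK σ𝔤 →
          (∃ T₁ : P.archModuleCM ι T hT →ₗ[ℂ] M,
            (∀ (k : (uFormGroup (Fin 2) (Fin 1)).maximalCompact) (w : P.archModuleCM ι T hT), T₁ (P.archRepKCM ι T hT k w) = σK k (T₁ w)) ∧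
              (∀ (X : (uFormGroup (Fin 2) (Fin 1)).lie) (w : P.archModuleCM ι T hT), T₁ (P.archRepLieCM ι T hT X w) = σ𝔤 X (T₁ w)) ∧ T₁ ≠ 0) →
          ∀ δ : ℤ, (δ = 1 ∨ δ = -1) → upqTypeClasses σK σ𝔤 hM.ad_compat 1 δ ≠ ⊥ →
            ∃ ξ : OneDimAutRepH L, MemXiFamily P (transpose_map_cmConjRingHom_eq_of_frame L ι H T hT) (isUnit_det_of_frame L ι H T hT) μω hμu ξ ∧
              ∀ k : InfinitePlace L → ℤ, μω.HasUnitaryArchType k (fun _ => 0) → ∀ ι' : L →+* ℂ, ξ.IsCohTrivialAt (ArchSignRecipe.tOfArchType k ι') ι') ∧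
      (∃ sgn : OneDimAutRepH L → ℤ, ∀ (P : DiscreteAutomorphicRep (adelicGroupData (↥(maximalRealSubfield L)) L (IsCMField.complexConj L) 3 H) μ),
          (P.IsHolCotangentAt (cmArchSection L ι H T hT) (cmCompactFactor L ι H T hT) ∨
            P.IsAntiholCotangentAt (cmArchSection L ι H T hT) (cmCompactFactor L ι H T hT)) →
          (∀ k : (adelicGroupData (↥(maximalRealSubfield L)) L (IsCMField.complexConj L) 3 H).Adelic, k ∈ cmCompactFactor L ι H T hT → ∀ v : P.space.toSubmodule, (adelicGroupData (↥(maximalRealSubfield L)) L (IsCMField.complexConj L) 3 H).rightRegular μ k (v : (adelicGroupData (↥(maximalRealSubfield L)) L (IsCMField.complexConj L) 3 H).L2 μ) = v) → ∀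
          (M : Type) [AddCommGroup M] [Module ℂ M]
          (σK : Representation ℂ (uFormGroup (Fin 2) (Fin 1)).maximalCompact M) (σ𝔤 : (uFormGroup (Fin 2) (Fin 1)).lie →ₗ⁅ℝ⁆ Module.End ℂ M)
          (hM : IsGKModule (uFormGroup (Fin 2) (Fin 1)) σK σ𝔤), IsIrreducibleGK σK σ𝔤 →
          (∃ T₁ : P.archModuleCM ι T hT →ₗ[ℂ] M,
            (∀ (k : (uFormGroup (Fin 2) (Fin 1)).maximalCompact) (w : P.archModuleCM ι T hT), T₁ (P.archRepKCM ι T hT k w) = σK k (T₁ w)) ∧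
              (∀ (X : (uFormGroup (Fin 2) (Fin 1)).lie) (w : P.archModuleCM ι T hT), T₁ (P.archRepLieCM ι T hT X w) = σ𝔤 X (T₁ w)) ∧ T₁ ≠ 0) →
          ∀ δ : ℤ, (δ = 1 ∨ δ = -1) → upqTypeClasses σK σ𝔤 hM.ad_compat 1 δ ≠ ⊥ →
            ∃ ξ : OneDimAutRepH L, MemXiFamily P (transpose_map_cmConjRingHom_eq_of_frame L ι H T hT) (isUnit_det_of_frame L ι H T hT) μω hμu ξ ∧ δ = sgn ξ ∧
              ∀ k : InfinitePlace L → ℤ, μω.HasUnitaryArchType k (fun _ => 0) → ∀ ι' : L →+* ℂ, ξ.IsCohTrivialAt (ArchSignRecipe.tOfArchType k ι') ι')) :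
    F0P3ThreadLetters3Defs.StubE1coh₃ ∧ F0P3ThreadLetters3Defs.HodgeTypeRigid₃ :=
  ⟨(stubs_of_guardedEngine₃ h).1, hodgeTypeRigid_of_betaOppAdmCot_cpt₃ (stubs_of_guardedEngine₃ h).2 stubF1aCM_holds⟩

end Summit.HodgeConjecture.HodgeConjecture.Cruxes.H413.F0P3GuardedLettersOfGuardedShape3

end
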